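import Summits.ResolutionOfSingularities.ResolutionOfSingularities.Theorems.MarkedTransferCampaignW46MohWindowShadeFormalInsepAnchor
import Summits.ResolutionOfSingularities.ResolutionOfSingularities.Theorems.MarkedTransferCampaignW46MohWindowShadeFormalInsepStep
import Summits.ResolutionOfSingularities.ResolutionOfSingularities.Theorems.MarkedTransferCampaignW46MohWindowShadePSBranch
import Summits.ResolutionOfSingularities.ResolutionOfSingularities.Theorems.MarkedTransferCampaignW46MohWindowShadeFormalWalk
import HarnessLib

/-!
# [OURS · L1 W4.6 rung (iii-2), FORMAL ENTRANCE DOOR for POWER-SERIES residuals, brick 3] The hit thread carries the SERIES shade-model walk: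
# no infinite sequence with a formally purely inseparable root

Cell `res-hironaka`, LADDER-RESOLUTION rung L (D-0089), slot W4.6 rung (iii); seat res-L1-s46-pv-6 (gen 6). Host route MarkedTransfer,
`--supports stmt-ResolutionOfSingularities-16155 --as helper`; kind proof (no definition). Series twin of gen 5's `…FormalWalk` (p532294): the
recursion along res-L1-s46-pv-1's hit thread builds SERIES anchors (`formalInsepAnchor_succ`, brick 2c), the hit stages (`Nat.nth`) form an
infinite in-window equimultiple Hauser–Wagner walk of SERIES states, THE MODEL THEOREM OF THE POWER-SERIES PORT
(`MohWindowShadePS.Series.exists_coordinate_or_digit_curve_of_walk`, p545505) produces a formal `p`-fold curve, and res-D-pv-050's exit door closes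
(`false_of_hitThread_formalInsepAnchor`); the regime's own anchor at the root (ANY power series) is first cleaned by a vertical shear
(`false_of_hitThread_formalInsepAt`); stage-0 form over algebraically closed fields (`false_of_permissibleRun_insep_formalInsepStart`). OURS; NOT a
statement of the manuscript [claim: Hironaka2017, status: under-review], nothing of which is used. AI review is weaker than expert review.
References: H. Hauser, Bull. AMS 47 (2010) §§F–G; Stacks Project Tags 0804, 0CY7. [Hauser2010] [StacksProject] [folklore]
-/

noncomputable section

set_option linter.dupNamespace false -- mandated namespace of this single-conjunct summit

open IsLocalRing MvPolynomial

namespace Summit.ResolutionOfSingularities.ResolutionOfSingularities.Theorems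

namespace CampaignW46

namespace MohWindowShadeFormalInsep

open CategoryTheory AlgebraicGeometry TopologicalSpace
open Literature.AlgebraicGeometry.Resolution
open Literature.AlgebraicGeometry.Resolution.PointBlowup
open Literature.AlgebraicGeometry.Resolution.Hauser2010
open Literature.AlgebraicGeometry.Hironaka2017.S02Preliminaries
open Literature.AlgebraicGeometry.Hironaka2017.Datum
open Scheme.IdealSheafData
open MohWindowShadePS
open MohWindowShadeFormalStep (exists_formalAnchor_offCentre)

variable {p : ℕ} [hp : Fact p.Prime] {K : Type} [Field K] [CharP K p]

/-! ## §1 One step along a hit thread -/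

section Thread

variable [PerfectRing K p] [DecidableEq K]

/-- **One step along a hit thread, formal anchors.** [OURS · L1 W4.6 rung (iii-2)] NOT a statement of the manuscript. See the module docstring.
[cite: StacksProject, Tag 0804] -/
theorem formalInsepAnchor_succ (r : PermissibleRun p K) (hr : ∀ k, regimeMohWindowSurfaceInsep (p := p) (K := K) (r.A k) (r.E k))
    (t : r.HitThread) (k : ℕ)
    (hrat : ∀ y : (r.A (k + 1)).Z.presheaf.stalk (t.y (k + 1)), ∃ x : (r.A k).Z.presheaf.stalk ((r.π k).base (t.y (k + 1))),
      y - ((r.π k).stalkMap (t.y (k + 1))).hom x ∈ maximalIdeal _)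
    (s : Series (Fin 2) K)
    (hA : ∃ (e : AdicCompletion (maximalIdeal ((r.A k).Z.presheaf.stalk (t.y k))) ((r.A k).Z.presheaf.stalk (t.y k)) ≃+*
        MvPowerSeries (Option (Fin 2)) K) (f₀ : (r.A k).Z.presheaf.stalk (t.y k)) (w : MvPowerSeries (Option (Fin 2)) K),
      stalkIdeal (r.E k).J (t.y k) = Ideal.span {f₀} ∧ IsUnit w ∧
        e (algebraMap _ _ f₀) = w * (MvPowerSeries.X none ^ p +
          MvPowerSeries.rename (some : Fin 2 → Option (Fin 2)) s.F)) :
    ∃ (s' : Series (Fin 2) K) (c : Fin 2) (b : Fin 2 → K),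
      ((r.D k : Set (r.A k).Z) = {t.y k} → s' = s.step p c b ∧ b c = 0 ∧ (c = 1 → ∀ l, b l = 0) ∧ s.IsEquimultiplePoint p c b) ∧
      ((r.D k : Set (r.A k).Z) ≠ {t.y k} → s' = s) ∧
      ∃ (e : AdicCompletion (maximalIdeal ((r.A (k + 1)).Z.presheaf.stalk (t.y (k + 1)))) ((r.A (k + 1)).Z.presheaf.stalk (t.y (k + 1))) ≃+*
          MvPowerSeries (Option (Fin 2)) K) (f₀ : (r.A (k + 1)).Z.presheaf.stalk (t.y (k + 1))) (w : MvPowerSeries (Option (Fin 2)) K),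
        stalkIdeal (r.E (k + 1)).J (t.y (k + 1)) = Ideal.span {f₀} ∧ IsUnit w ∧
          e (algebraMap _ _ f₀) = w * (MvPowerSeries.X none ^ p +
            MvPowerSeries.rename (some : Fin 2 → Option (Fin 2)) s'.F) := by
  classical
  -- data at stage `k`, moved to the point `π (y (k+1))`
  have hc := t.compat k
  have hmem : (r.π k).base (t.y (k + 1)) ∈ (r.E k).sing := by rw [hc]; exact t.mem k
  obtain ⟨hR, h3, hcl, -, hb⟩ := MohWindowShadeAnchorWalk.regime_point (hr k) hmem
  haveI := hR
  have hA' : ∃ (e : AdicCompletion (maximalIdeal ((r.A k).Z.presheaf.stalk ((r.π k).base (t.y (k + 1)))))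
        ((r.A k).Z.presheaf.stalk ((r.π k).base (t.y (k + 1)))) ≃+* MvPowerSeries (Option (Fin 2)) K)
      (f₀ : (r.A k).Z.presheaf.stalk ((r.π k).base (t.y (k + 1)))) (w : MvPowerSeries (Option (Fin 2)) K),
      stalkIdeal (r.E k).J ((r.π k).base (t.y (k + 1))) = Ideal.span {f₀} ∧ IsUnit w ∧
        e (algebraMap _ _ f₀) = w * (MvPowerSeries.X none ^ p +
          MvPowerSeries.rename (some : Fin 2 → Option (Fin 2)) s.F) := by
    rw [hc]; exact hA
  obtain ⟨e, f₀, w, hJ, hw, hE⟩ := hA'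
  have hwin := window_of_formalInsepAnchor (hr k) hmem e hJ hw s.F hE
  obtain ⟨o, ho, -⟩ := s.exists_order_eq_of_lt hwin.2
  have hpo : p ≤ o := by have := hwin.1; rw [ho] at this; exact_mod_cast this
  have hsing' : t.y (k + 1) ∈ ((r.E k).transform (r.π k) (r.D k)).sing := by
    have := t.mem (k + 1); rwa [r.E_succ k] at this
  by_cases hhit : (r.D k : Set (r.A k).Z) = {t.y k}
  · -- the thread point is blown up: the model takes a step
    have hD : (r.D k : Set (r.A k).Z) = {(r.π k).base (t.y (k + 1))} := by rw [hc]; exact hhit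
    obtain ⟨c, b, e', f', w', hbc, hHW, heq, hJ', hw', hE'⟩ :=
      exists_formalInsepAnchor_step (r.π k) (r.D k) (r.blowup k) hb hD hmem hsing' h3 hrat e hJ hw s ho hpo hE
    refine ⟨s.step p c b, c, b, fun _ => ⟨rfl, hbc, hHW, heq⟩, fun h => absurd hhit h, e', f', w', ?_, hw', hE'⟩
    rw [r.E_succ k]; exact hJ'
  · -- the thread point is not blown up: transport
    obtain ⟨ξ₀, -, -, hDξ₀⟩ := IsPermissibleCentre.exists_eq_singleton_of_isolatedSing (r.permissible k)
      ((regimeMohWindowSurfaceInsep_iff _ _).mp (hr k)).1.1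
    have hoff : (r.π k).base (t.y (k + 1)) ∉ (r.D k : Set (r.A k).Z) := by
      rw [hc, hDξ₀, Set.mem_singleton_iff]
      rintro rfl
      exact hhit hDξ₀
    obtain ⟨e', f', hJ', hE'⟩ := exists_formalAnchor_offCentre (E := r.E k) (r.π k) (r.blowup k) hoff e hJ _ hE
    refine ⟨s, 0, 0, fun h => absurd h hhit, fun _ => rfl, e', f', w, ?_, hw, hE'⟩
    rw [r.E_succ k]; exact hJ'

/-! ## §2 The theorem -/

/-- **THE FORMAL ENTRANCE DOOR CLOSES ON THE EXIT DOOR.** [OURS · L1 W4.6 rung (iii-2)] NOT a statement of the manuscript. An infinite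
§2.1-permissible sequence inside o1's regime `regimeMohWindowSurfaceInsep` with a hit thread whose points are residually rational over their
images and whose initial point carries a FORMAL anchor with CLEANED model polynomial `F₀` does not exist: the thread carries the shade-model walk
(`formalAnchor_succ`), the walk is infinite, in the window and equimultiple, so by this seat's gen-3 theorem it meets a formal `p`-fold curve,
which res-D-pv-050's exit door forbids in the regime. [cite: Hauser2010, §F (setting f = x^p + y^r g)] [cite: StacksProject, Tag 0804] -/
theorem false_of_hitThread_formalInsepAnchor (r : PermissibleRun p K)
    (hr : ∀ k, regimeMohWindowSurfaceInsep (p := p) (K := K) (r.A k) (r.E k)) (t : r.HitThread)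
    (hrat : ∀ k (y : (r.A (k + 1)).Z.presheaf.stalk (t.y (k + 1))), ∃ x : (r.A k).Z.presheaf.stalk ((r.π k).base (t.y (k + 1))),
      y - ((r.π k).stalkMap (t.y (k + 1))).hom x ∈ maximalIdeal _)
    (F₀ : MvPowerSeries (Fin 2) K) (hclean : IsClean p F₀)
    (hA0 : ∃ (e : AdicCompletion (maximalIdeal ((r.A 0).Z.presheaf.stalk (t.y 0))) ((r.A 0).Z.presheaf.stalk (t.y 0)) ≃+*
        MvPowerSeries (Option (Fin 2)) K) (f₀ : (r.A 0).Z.presheaf.stalk (t.y 0)) (w : MvPowerSeries (Option (Fin 2)) K),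
      stalkIdeal (r.E 0).J (t.y 0) = Ideal.span {f₀} ∧ IsUnit w ∧
        e (algebraMap _ _ f₀) = w * (MvPowerSeries.X none ^ p +
          MvPowerSeries.rename (some : Fin 2 → Option (Fin 2)) F₀)) :
    False := by
  classical
  -- the anchor predicate at stage `k` for a model state
  let Anch : ∀ k, Series (Fin 2) K → Prop := fun k s =>
    ∃ (e : AdicCompletion (maximalIdeal ((r.A k).Z.presheaf.stalk (t.y k))) ((r.A k).Z.presheaf.stalk (t.y k)) ≃+*
        MvPowerSeries (Option (Fin 2)) K) (f₀ : (r.A k).Z.presheaf.stalk (t.y k)) (w : MvPowerSeries (Option (Fin 2)) K),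
      stalkIdeal (r.E k).J (t.y k) = Ideal.span {f₀} ∧ IsUnit w ∧
        e (algebraMap _ _ f₀) = w * (MvPowerSeries.X none ^ p +
          MvPowerSeries.rename (some : Fin 2 → Option (Fin 2)) s.F)
  -- the anchors along the thread, by recursion
  have G : ∀ (k : ℕ) (P : {s : Series (Fin 2) K // Anch k s}),
      ∃ (Q : {s : Series (Fin 2) K // Anch (k + 1) s}) (c : Fin 2) (b : Fin 2 → K),
        ((r.D k : Set (r.A k).Z) = {t.y k} → Q.1 = P.1.step p c b ∧ b c = 0 ∧ (c = 1 → ∀ l, b l = 0) ∧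
          P.1.IsEquimultiplePoint p c b) ∧
        ((r.D k : Set (r.A k).Z) ≠ {t.y k} → Q.1 = P.1) := by
    intro k P
    obtain ⟨s', c, b, h1, h2, hA'⟩ := formalInsepAnchor_succ r hr t k (hrat k) P.1 P.2
    exact ⟨⟨s', hA'⟩, c, b, h1, h2⟩
  choose next nc nb hnext using G
  let seq : ∀ k, {s : Series (Fin 2) K // Anch k s} :=
    fun k => Nat.rec (motive := fun k => {s : Series (Fin 2) K // Anch k s}) ⟨⟨F₀, 0⟩, hA0⟩ (fun k P => next k P) k
  have hseq : ∀ k, seq (k + 1) = next k (seq k) := fun k => rfl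
  have hseq0 : (seq 0).1 = ⟨F₀, 0⟩ := rfl
  -- the hit stages
  set P : ℕ → Prop := fun k => (r.D k : Set (r.A k).Z) = {t.y k} with hP
  have hinf : (setOf P).Infinite :=
    Nat.frequently_atTop_iff_infinite.mp (Filter.frequently_atTop.mpr fun a => t.hit a)
  have hPnth : ∀ n, P (Nat.nth P n) := Nat.nth_mem_of_infinite hinf
  have hgap : ∀ n m, Nat.nth P n < m → m < Nat.nth P (n + 1) → ¬ P m := by
    intro n m h1 h2 hm
    obtain ⟨i, -, hi⟩ := Nat.exists_lt_card_nth_eq hm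
    rw [← hi] at h1 h2
    have := (Nat.nth_lt_nth hinf).mp h1
    have := (Nat.nth_lt_nth hinf).mp h2
    omega
  have hgap0 : ∀ m, m < Nat.nth P 0 → ¬ P m := by
    intro m h hm
    obtain ⟨i, -, hi⟩ := Nat.exists_lt_card_nth_eq hm
    rw [← hi] at h
    have := (Nat.nth_lt_nth hinf).mp h
    omega
  -- the state is constant off the hit stages
  have hstay : ∀ m, ¬ P m → (seq (m + 1)).1 = (seq m).1 := fun m hm => by
    rw [hseq]; exact (hnext m (seq m)).2 hm
  have hconst : ∀ n d, Nat.nth P n + 1 + d ≤ Nat.nth P (n + 1) →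
      (seq (Nat.nth P n + 1 + d)).1 = (seq (Nat.nth P n + 1)).1 := by
    intro n d
    induction d with
    | zero => intro _; rfl
    | succ d ih =>
      intro hle
      have h1 : (seq (Nat.nth P n + 1 + d + 1)).1 = (seq (Nat.nth P n + 1 + d)).1 :=
        hstay _ (hgap n _ (by omega) (by omega))
      rw [← ih (by omega), ← h1]
      rfl
  have hconst0 : ∀ d, d ≤ Nat.nth P 0 → (seq d).1 = (seq 0).1 := by
    intro d
    induction d with
    | zero => intro _; rfl
    | succ d ih =>
      intro hle
      rw [hstay d (hgap0 d (by omega))]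
      exact ih (by omega)
  -- the model walk
  set sM : ℕ → Series (Fin 2) K := fun n => (seq (Nat.nth P n)).1 with hsM
  set cM : ℕ → Fin 2 := fun n => nc (Nat.nth P n) (seq (Nat.nth P n)) with hcM
  set bM : ℕ → Fin 2 → K := fun n => nb (Nat.nth P n) (seq (Nat.nth P n)) with hbM
  have hhitrel : ∀ n, (seq (Nat.nth P n + 1)).1 = (sM n).step p (cM n) (bM n) ∧ bM n (cM n) = 0 ∧
      (cM n = 1 → ∀ l, bM n l = 0) ∧ (sM n).IsEquimultiplePoint p (cM n) (bM n) := by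
    intro n
    have h := (hnext (Nat.nth P n) (seq (Nat.nth P n))).1 (hPnth n)
    rw [← hseq] at h
    exact h
  have hstepM : ∀ n, sM (n + 1) = (sM n).step p (cM n) (bM n) := by
    intro n
    have hlt : Nat.nth P n < Nat.nth P (n + 1) := (Nat.nth_lt_nth hinf).mpr (Nat.lt_succ_self n)
    obtain ⟨d, hd⟩ : ∃ d, Nat.nth P (n + 1) = Nat.nth P n + 1 + d := ⟨Nat.nth P (n + 1) - (Nat.nth P n + 1), by omega⟩
    rw [← (hhitrel n).1]
    show (seq (Nat.nth P (n + 1))).1 = _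
    rw [hd]
    exact hconst n d (by omega)
  have hwinM : ∀ n, (p : ℕ∞) ≤ (sM n).F.order ∧ (sM n).F.order < (2 * p : ℕ) := by
    intro n
    obtain ⟨e, f₀, w, hJ, hw, hE⟩ := (seq (Nat.nth P n)).2
    exact window_of_formalInsepAnchor (hr _) (t.mem _) e hJ hw _ hE
  have hsM0 : sM 0 = ⟨F₀, 0⟩ := by
    show (seq (Nat.nth P 0)).1 = _
    rw [hconst0 _ le_rfl, hseq0]
  -- the gen-3 termination theorem
  obtain ⟨n, hcurve⟩ := MohWindowShadePS.Series.exists_coordinate_or_digit_curve_of_walk p (σ := Fin 2) (j := (0 : Fin 2))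
    (i := 1) (by decide) (fun l => by fin_cases l <;> simp) sM cM bM (fun n => (hhitrel n).2.1) (fun n => (hhitrel n).2.2.1)
    hstepM (by rw [hsM0]; exact hclean) (by rw [hsM0]; intro d _; exact zero_le) (fun n => (hhitrel n).2.2.2) hwinM
  -- the exit at the stage `Nat.nth P n`
  set k := Nat.nth P n with hk
  obtain ⟨e, f₀, w, hJ, hw, hE⟩ := (seq k).2
  obtain ⟨-, -, -, -, hb⟩ := MohWindowShadeAnchorWalk.regime_point (hr k) (t.mem k)
  rcases hcurve with ⟨l, W, hF⟩ | ⟨W, hF⟩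
  · exact not_regime_of_formalInsepAnchor_coordinate (r.A k) (r.E k) (t.y k) hb e hJ hw l W hF hE (hr k)
  · exact not_regime_of_formalInsepAnchor_digit (r.A k) (r.E k) (t.y k) hb e hJ hw _ W hF hE (hr k)



/-! ## §3 Stage-0 form: the regime's own (uncleaned) anchor at the root, cleaned by a shear -/

/-- **STAGE-0 FORM, SERIES ANCHORS, over a perfect field with residually rational thread points.** [OURS · L1 W4.6 rung (iii-2)] NOT a statement
of the manuscript. An infinite §2.1-permissible sequence inside o1's regime `regimeMohWindowSurfaceInsep` with a hit thread whose points are residually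
rational over their images and whose ROOT is formally purely inseparable (`MohWindowSurfaceFormalInsepAt`, ANY power series `F`) does not exist: clean
the root anchor (`exists_clean_formalInsepAnchor`) and apply `false_of_hitThread_formalInsepAnchor`. [cite: Hauser2010, §G (cleaning of p-th power monomials)] -/
theorem false_of_hitThread_formalInsepAt (r : PermissibleRun p K)
    (hr : ∀ k, regimeMohWindowSurfaceInsep (p := p) (K := K) (r.A k) (r.E k)) (t : r.HitThread)
    (hrat : ∀ k (y : (r.A (k + 1)).Z.presheaf.stalk (t.y (k + 1))), ∃ x : (r.A k).Z.presheaf.stalk ((r.π k).base (t.y (k + 1))),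
      y - ((r.π k).stalkMap (t.y (k + 1))).hom x ∈ maximalIdeal _)
    (h0 : MohWindowSurfaceFormalInsepAt p K ((r.A 0).Z.presheaf.stalk (t.y 0)) (stalkIdeal (r.E 0).J (t.y 0))) : False := by
  classical
  obtain ⟨e, f₀, w, F, hJ, hw, hE⟩ := h0
  obtain ⟨hR, -, -, -, hb⟩ := MohWindowShadeAnchorWalk.regime_point (hr 0) (t.mem 0)
  haveI := hR
  have hf₀ : f₀ ∈ maximalIdeal ((r.A 0).Z.presheaf.stalk (t.y 0)) := by
    have h := (le_idealOrder_iff (r.E 0).J (t.y 0) (r.E 0).b).mp (t.mem 0)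
    rw [hJ, Ideal.span_singleton_le_iff_mem, hb] at h
    exact Ideal.pow_le_self hp.out.ne_zero h
  obtain ⟨e', w', F', hw', hclean, -, hE'⟩ := exists_clean_formalInsepAnchor p e hf₀ hw F hE
  exact false_of_hitThread_formalInsepAnchor r hr t hrat F' hclean ⟨e', f₀, w', hJ, hw', hE'⟩

end Thread

/-! ## §4 Stage-0 form over algebraically closed fields -/

/-- **STAGE-0 FORM, SERIES ANCHORS, algebraically closed field.** [OURS · L1 W4.6 rung (iii-2)] NOT a statement of the manuscript. Over an
algebraically closed field there is NO infinite §2.1-permissible sequence inside o1's regime of record `regimeMohWindowSurfaceInsep` whose INITIAL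
singular points are formally purely inseparable (`MohWindowSurfaceFormalInsepAt`: `J_ξ 𝒪̂_ξ = (z^p + F(u₀, u₁))` in SOME Cohen coordinates, `F` ANY power
series): such a sequence has a hit thread (res-L1-s46-pv-1) with residually rational closed points (Zariski's lemma), rooted at an anchored point.
[cite: StacksProject, Tag 0CY7] -/
theorem false_of_permissibleRun_insep_formalInsepStart [IsAlgClosed K] (r : PermissibleRun p K)
    (hr : ∀ k, regimeMohWindowSurfaceInsep (p := p) (K := K) (r.A k) (r.E k))
    (h0 : ∀ ξ ∈ (r.E 0).sing, MohWindowSurfaceFormalInsepAt p K ((r.A 0).Z.presheaf.stalk ξ) (stalkIdeal (r.E 0).J ξ)) : False := by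
  classical
  obtain ⟨t⟩ := r.nonempty_hitThread fun k => ((regimeMohWindowSurfaceInsep_iff _ _).mp (hr k)).1.1
  refine false_of_hitThread_formalInsepAt r hr t (fun k y => ?_) (h0 (t.y 0) (t.mem 0))
  -- closed points over an algebraically closed field are rational over their images
  haveI : LocallyOfFiniteType (r.π k ≫ (r.A k).hom) := by
    rw [← r.hom_eq k]
    haveI := (r.A (k + 1)).smooth
    infer_instance
  obtain ⟨-, -, hcl, -, -⟩ := MohWindowShadeAnchorWalk.regime_point (hr (k + 1)) (t.mem (k + 1))
  exact CampaignW46.ChartPoint.exists_sub_stalkMap_mem_maximalIdeal_of_isClosed (r.π k) (r.A k).hom (t.y (k + 1)) hcl y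

end MohWindowShadeFormalInsep

end CampaignW46

end Summit.ResolutionOfSingularities.ResolutionOfSingularities.Theorems

end
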